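import Mathlib
import HarnessLib
import Summits.NavierStokesRegularity.NavierStokesRegularity.Theorems.QuarterLogPincerSilencingCostDefs
import Literature.Analysis.FluidPDE.WeakSolution

/-!
# Route `QuarterLogPincer`, crux `TypeIQuantSubcubicExp` (stmt-NavierStokesRegularity-24077), line `smooth_silence` —
# the line's OBJECTS, verbatim (Defs file)

VERBATIM port of the statement objects of ns-idea-7's workfile `Cruxes/TypeIQuantSubcubicExp/Lines/smooth_silence.lean`
(v1.1 «C12 upgrade», 0daf952d54b0; idea-crit-4 g8 RE-STAMP PASS 2026-08-29T07:46Z): §S `SharpBoxBound` (+ `SharpBoxBound.boxBound`,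
`sharpBoxBound_mono`), Sa♯ `SharpAftermath`, §D `DriftStretchBox`, Sv♯ `VorticityTransport`, Sc″ `DriftStretchSilencingCost`, Sc♯
`SharpEnstrophyPersistence`, §W `SmoothVanishingWitness`, §L `SmoothFailingFamily`, L♯1 `SmoothNormalisation`, L♯2 `SmoothLimitStep`,
in the namespace `…Cruxes.TypeIQuantSubcubicExp.SmoothSilence`.  The §E/§S objects the workfile restates byte-identically (crit-4
07:07Z/07:46Z) are IMPORTED from their homes instead: `Hot`, `Terminal`, `TerminalEmber` (`…EmberCensusDefs`), `BoxBound`,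
`boxBound_mono`, Sb `VorticalCentre`, Sd `EmberReadout` (`…SilencingCostDefs`).  Only textual change: local notation `E3` unfolded
(no notation declared); docstrings added to the two undocumented `SharpBoxBound` lemmas.  No stub is proved here.  HONEST FRAME: Props
about HYPOTHETICAL Type-I classical solutions and a linear drift–stretch class; nothing here bears on 24077's truth, W7 or
Navier–Stokes regularity (OPEN / not proved).  pub-ns-dss typer (g38), `--supports stmt-NavierStokesRegularity-24077`; text by
ns-idea-7 (g12).
-/

set_option linter.dupNamespace false

namespace Summit.NavierStokesRegularity.NavierStokesRegularity.Cruxes.TypeIQuantSubcubicExp.SmoothSilence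

noncomputable section

open MeasureTheory Set Function Filter Topology Metric
open scoped ENNReal NNReal Classical Laplacian InnerProductSpace RealInnerProductSpace
open Literature.Analysis Literature.Analysis.FluidPDE
open Summit.NavierStokesRegularity.NavierStokesRegularity.Cruxes.TypeIQuantSubcubicExp.EmberCensus (Hot Terminal TerminalEmber)
open Summit.NavierStokesRegularity.NavierStokesRegularity.Cruxes.TypeIQuantSubcubicExp.SilencingCost
  (BoxBound boxBound_mono VorticalCentre EmberReadout)

/-- **SHARP BOX BOUND at scale `σ`** (this line's class; v1.1 = one order higher than v1, so that L♯2's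
limit lands in the tree's class `C¹₂`): on `S × B(y,ρ)` the velocity has the scale-`σ` bounds
`‖∇ʲu(s,x)‖ ≤ M₁σ^{-(j+1)}` for ALL `j ≤ 6`, and `u`, `∇u`, `∇²u` have a scale-`σ` `γ`-HÖLDER MODULUS IN TIME
`‖∇ⁱu(s,x) − ∇ⁱu(s',x)‖ ≤ M₁σ^{-(i+1)}(|s−s'|/σ²)^γ` (`i ≤ 2`) with an exponent `γ > 0` (the pressure argument of Sa♯ gives `γ = ⅓` — `∂ₜu ∈ L^∞ + L^{3/2}_t L^∞_x`: `Δu − u·∇u` is bounded and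
the harmonic part of the pressure gradient is in `L^{3/2}_t L^∞_x` by the I1 pressure bound; parabolic
ε-regularity [Seregin LN Lemma 6.1, p.90] gives some Hölder exponent directly; ANY `γ > 0` serves L♯2). -/
def SharpBoxBound (M₁ γ σ : ℝ) (u : ℝ → (EuclideanSpace ℝ (Fin 3)) → (EuclideanSpace ℝ (Fin 3)))
    (y : (EuclideanSpace ℝ (Fin 3))) (S : Set ℝ) (ρ : ℝ) : Prop :=
  (∀ s ∈ S, ∀ x ∈ ball y ρ, ∀ j : ℕ, j ≤ 6 →
    ‖iteratedFDeriv ℝ j (u s) x‖ ≤ M₁ * σ ^ (-((j : ℝ) + 1))) ∧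
  (∀ s ∈ S, ∀ s' ∈ S, ∀ x ∈ ball y ρ,
    ‖u s x - u s' x‖ ≤ M₁ * σ ^ (-(1 : ℝ)) * (|s - s'| / σ ^ 2) ^ γ ∧
    ‖fderiv ℝ (u s) x - fderiv ℝ (u s') x‖ ≤ M₁ * σ ^ (-(2 : ℝ)) * (|s - s'| / σ ^ 2) ^ γ ∧
    ‖iteratedFDeriv ℝ 2 (u s) x - iteratedFDeriv ℝ 2 (u s') x‖ ≤
      M₁ * σ ^ (-(3 : ℝ)) * (|s - s'| / σ ^ 2) ^ γ)

/-- The sharp box bound contains the `C²` box bound (`j ≤ 2` from `j ≤ 6`). -/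
theorem SharpBoxBound.boxBound {M₁ γ σ : ℝ} {u : ℝ → (EuclideanSpace ℝ (Fin 3)) → (EuclideanSpace ℝ (Fin 3))}
    {y : (EuclideanSpace ℝ (Fin 3))} {S : Set ℝ} {ρ : ℝ}
    (h : SharpBoxBound M₁ γ σ u y S ρ) : BoxBound M₁ σ u y S ρ :=
  fun s hs x hx j hj => h.1 s hs x hx j (hj.trans (by norm_num))

/-- `SharpBoxBound` is monotone in the radius. -/
theorem sharpBoxBound_mono {M₁ γ σ : ℝ} {u : ℝ → (EuclideanSpace ℝ (Fin 3)) → (EuclideanSpace ℝ (Fin 3))}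
    {y : (EuclideanSpace ℝ (Fin 3))} {S : Set ℝ} {ρ ρ' : ℝ}
    (h : SharpBoxBound M₁ γ σ u y S ρ) (hρ : ρ' ≤ ρ) : SharpBoxBound M₁ γ σ u y S ρ' :=
  ⟨fun s hs x hx j hj => h.1 s hs x (ball_subset_ball hρ hx) j hj,
    fun s hs s' hs' x hx => h.2 s hs s' hs' x (ball_subset_ball hρ hx)⟩

/-- **Sa♯ — `SharpAftermath` (size M–L; PUBLISHED MECHANISMS + the tree's PROVED I1; `A`-free; replaces Sa
`RegularAftermath` of `silencing_cost`, whose conclusion it strengthens from the `C²` box bound to the SHARP box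
bound).**  There is an absolute `ε₀ > 0` such that for `0 < ε ≤ ε₀`, `M ≥ 1` there is `M₁ = M₁(ε,M) ≥ 1`,
INDEPENDENT of the aperture, with: in the crux frame with virtual rate `M`, for every `K ≥ 1`, an ε-hot event
`(y,t)` that is `K`-terminal up to `t₁` has the sharp box bound at scale `σ = √(T'−t)` on
`[t,t₁] × B(y,2Kσ)`.  Mechanism — spatial part exactly as Sa (rate where the clock is `≥ σ²/8`; terminal
COLDNESS + Gustafson–Kang–Tsai `(∞,1)` ε-regularity seeded by I1 where it is not), upgraded from `j ≤ 2` to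
`j ≤ 6` by higher interior regularity (Serrin 1962; Ladyzhenskaya–Seregin 1999 / Seregin LN Lemma 6.1 + Remark
6.1, p.90: near a regular point `∇^{k−1}u` is Hölder continuous IN SPACE–TIME for every `k` — which is ALSO the
printed source of the time moduli of `u, ∇u, ∇²u`); temporal part, quantitatively: at a point `x₀` of the box apply I1
(`UniformScaledEnergy`, PROVED: `Theorems/…StubUniformScaledEnergy.lean`) at CENTRE `x₀` and SCALE `σ`
(`σ² ≤ t` is the hot event's room) — its third clause bounds `σ⁻²∫∫_{Q_σ(x₀)}|p − (p)_σ|^{3/2} ≤ C(M)`, so the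
harmonic part `h` of `p − (p)_σ` in `B(x₀,σ)` has `∇h, ∇²h ∈ L^{3/2}_t L^∞(B(x₀,σ/2))` with scale-covariant
norm `C(M)`, while the local part of the pressure and `Δu − u·∇u` are bounded by the spatial bounds; hence
`∂ₜ∇ⁱu ∈ L^∞ + L^{3/2}_t L^∞_x` (`i ≤ 2`; interior harmonic estimates control EVERY `∇ⁱh`) and `⅓`-Hölder
moduli follow (`W^{1,3/2} ⊂ C^{0,1/3}` in time; the statement asks for SOME `γ > 0`), with
constants depending on `M` only — NOT on `K`.  Why it might fail: not as mathematics (every step in print; I1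
in the tree); porting cost M–L (quantitative ε-regularity with explicit seed, as for Sa, plus the local
pressure decomposition).  Sources: arXiv:math/0607114 Thm 1.1; [CaffarelliKohnNirenberg1982] Prop. 1–2;
Serrin, ARMA 9 (1962); Ladyzhenskaya–Seregin, J. Math. Fluid Mech. 1 (1999) Thms 1.1–1.2; Seregin, Lecture
Notes (2014) Ch. 6 [corpus:book:seregin2014-lecture-notes-regularity-theory-navier-stokes-equations];
I1 = `ThinCascade.stub_uniformScaledEnergy` (tree, proved). -/
def SharpAftermath : Prop :=
  ∃ ε₀ : ℝ, 0 < ε₀ ∧ ∀ ε M : ℝ, 0 < ε → ε ≤ ε₀ → 1 ≤ M → ∃ M₁ γ : ℝ, 1 ≤ M₁ ∧ 0 < γ ∧ ∀ K : ℝ, 1 ≤ K →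
    ∀ (T τ : ℝ) (u : ℝ → (EuclideanSpace ℝ (Fin 3)) → (EuclideanSpace ℝ (Fin 3))) (p : ℝ → (EuclideanSpace ℝ (Fin 3)) → ℝ),
      (IsClassicalNSSolutionOn (Icc 0 T) 1 0 u p ∧
          ∀ m : ℕ, ∃ C : NNReal, ∀ t ∈ Icc 0 T, eLpNorm (iteratedFDeriv ℝ m (u t)) 2 volume ≤ C) →
        0 < τ →
        (∀ t ∈ Icc 0 T, ∀ x : (EuclideanSpace ℝ (Fin 3)), ‖u t x‖ ≤ M * (T + τ - t) ^ (-(1 / 2 : ℝ))) →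
        ∀ (t₁ : ℝ) (y : (EuclideanSpace ℝ (Fin 3))) (t : ℝ), t₁ ∈ Ioc 0 T → t ≤ t₁ →
          Hot ε (T + τ) u y t → Terminal K ε (T + τ) t₁ u y t →
          SharpBoxBound M₁ γ (Real.sqrt (T + τ - t)) u y (Icc t t₁) (2 * K * Real.sqrt (T + τ - t))

/-- **The drift–stretch class at scale `σ` on the box `S × B(y,ρ)`**: a pair of jointly smooth fields
`(ω, v)` on the slab `S × ℝ³` such that ON THE BOX `ω` has the scale-`σ` bounds `‖∇ʲω‖ ≤ Bσ^{-(j+2)}`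
(`j ≤ 5`), the coefficient `v` has `‖∇ʲv‖ ≤ Bσ^{-(j+1)}` (`j ≤ 4`) and the `γ`-Hölder time moduli of `v, ∇v, ∇²v`
of the sharp box bound (v1.1: one order higher than v1 throughout), and `ω` solves the LINEAR drift–stretch (vorticity-transport) equation
`∂ₛω = Δω + (ω·∇)v − (v·∇)ω` pointwise (`(ω·∇)v = Dv·ω = fderiv v x (ω x)`; one-sided time derivative within
`S`).  No Navier–Stokes object, no pressure, no rate, no `curl`, no divergence constraint: LINEAR in `ω` with a
smooth-bounded, time-Hölder coefficient.  For `v = u`, `ω = curl u` this is the vorticity equation. -/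
def DriftStretchBox (B γ σ : ℝ) (ω v : ℝ → (EuclideanSpace ℝ (Fin 3)) → (EuclideanSpace ℝ (Fin 3)))
    (y : (EuclideanSpace ℝ (Fin 3))) (S : Set ℝ) (ρ : ℝ) : Prop :=
  IsSmoothSpaceTimeOn S ω ∧ IsSmoothSpaceTimeOn S v ∧
  ∀ s ∈ S, ∀ x ∈ ball y ρ,
    (∀ j : ℕ, j ≤ 5 → ‖iteratedFDeriv ℝ j (ω s) x‖ ≤ B * σ ^ (-((j : ℝ) + 2))) ∧
    (∀ j : ℕ, j ≤ 4 → ‖iteratedFDeriv ℝ j (v s) x‖ ≤ B * σ ^ (-((j : ℝ) + 1))) ∧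
    (∀ s' ∈ S, ‖v s x - v s' x‖ ≤ B * σ ^ (-(1 : ℝ)) * (|s - s'| / σ ^ 2) ^ γ ∧
      ‖fderiv ℝ (v s) x - fderiv ℝ (v s') x‖ ≤ B * σ ^ (-(2 : ℝ)) * (|s - s'| / σ ^ 2) ^ γ ∧
      ‖iteratedFDeriv ℝ 2 (v s) x - iteratedFDeriv ℝ 2 (v s') x‖ ≤
        B * σ ^ (-(3 : ℝ)) * (|s - s'| / σ ^ 2) ^ γ) ∧
    timeDerivWithin S ω s x = (Δ (ω s)) x + fderiv ℝ (v s) x (ω s x) - fderiv ℝ (ω s) x (v s x)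

/-- **Sv♯ — `VorticityTransport` (size M; CALCULUS + the tree's PROVED vorticity formulation; replaces Sv).**
For `M₁ ≥ 1` there is `B = B(M₁) ≥ 1` (`B = 8M₁` will do): a classical solution on `[0,T]` with the SHARP box
bound at scale `σ` on `[t,t₁] × B(y,ρ)` (`0 ≤ t < t₁ ≤ T`) gives the pair `(curl u, u)` in the drift–stretch
class on the same box: joint smoothness (`smooth_velocity`, curl of a jointly smooth field), `‖∇ʲ curl u‖ ≤
2√3‖∇^{j+1}u‖ ≤ Bσ^{-(j+2)}` (`j ≤ 5` from `j+1 ≤ 6`), the three moduli forwarded, and the vorticity equation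
`∂ₛω = Δω + (ω·∇)u − (u·∇)ω` — the tree's PROVED `IsClassicalNSSolutionOn.isVorticitySolutionOn_Icc`
(`VorticityEquation.lean`; Majda–Bertozzi Prop. 2.21), with the time derivative within `[t,t₁]` equal to the
one within `[0,T]` (`IsSmoothSpaceTimeOn.timeDerivWithin_eq_of_subset`).  Why it might fail: it cannot in
substance; Lean work = matching the tree's `IsVorticitySolutionOn` form with the `fderiv` form used here and the
`iteratedFDeriv` bound for `curl`.  Sources: Majda–Bertozzi §2.4; tree `VorticityEquation.lean`. -/
def VorticityTransport : Prop :=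
  ∀ M₁ γ : ℝ, 1 ≤ M₁ → 0 < γ → ∃ B : ℝ, 1 ≤ B ∧
    ∀ (T : ℝ) (u : ℝ → (EuclideanSpace ℝ (Fin 3)) → (EuclideanSpace ℝ (Fin 3))) (p : ℝ → (EuclideanSpace ℝ (Fin 3)) → ℝ),
      IsClassicalNSSolutionOn (Icc 0 T) 1 0 u p →
    ∀ (y : (EuclideanSpace ℝ (Fin 3))) (σ ρ t t₁ : ℝ), 0 < σ → 0 ≤ t → t < t₁ → t₁ ≤ T →
      SharpBoxBound M₁ γ σ u y (Icc t t₁) ρ →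
      DriftStretchBox B γ σ (fun s => curl (u s)) u y (Icc t t₁) ρ

/-- **Sc″ — `DriftStretchSilencingCost` (the silencing cost IN THE LINEAR DRIFT–STRETCH CLASS; DERIVED below
from L♯1 + L♯2 + the tree's PROVED ESS chain — not a stub).**  For `B ≥ 1`, `δ > 0`, `Γ₂ ≥ 1` there are `K ≥ Γ₂` and
`c ∈ (0,δ]`: a pair `(ω,v)` in the drift–stretch class at scale `σ` on `[t,t₁] × B(y,2Kσ)` (`t < t₁ ≤ t + σ²`)
with centre mass `∫_{B(y,Γ₂σ)}|ω(t)|² ≥ δ/σ` keeps `∫_{B(y,Kσ)}|ω(t₁)|² ≥ c/σ`.  The analogue of Sc′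
`ThickBoxSilencingCost` of `silencing_cost`/`limit_silence` with the INEQUALITY replaced by the EQUATION with a
regular coefficient — weaker hypothesis-wise than nothing (it asks more of the data), and that is the point:
its failing families have limits in the tree's backward-uniqueness class `C¹₂`. -/
def DriftStretchSilencingCost : Prop :=
  ∀ B γ δ Γ₂ : ℝ, 1 ≤ B → 0 < γ → 0 < δ → 1 ≤ Γ₂ → ∃ K c : ℝ, Γ₂ ≤ K ∧ 0 < c ∧ c ≤ δ ∧
    ∀ (ω v : ℝ → (EuclideanSpace ℝ (Fin 3)) → (EuclideanSpace ℝ (Fin 3))) (y : (EuclideanSpace ℝ (Fin 3))) (σ t t₁ : ℝ),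
      0 < σ → t < t₁ → t₁ ≤ t + σ ^ 2 →
      DriftStretchBox B γ σ ω v y (Icc t t₁) (2 * K * σ) →
      ENNReal.ofReal (δ / σ) ≤ ∫⁻ x in ball y (Γ₂ * σ), ‖ω t x‖ₑ ^ 2 →
      ENNReal.ofReal (c / σ) ≤ ∫⁻ x in ball y (K * σ), ‖ω t₁ x‖ₑ ^ 2

/-- **Sc♯ — `SharpEnstrophyPersistence` (DERIVED: Sv♯ + Sc″; replaces Sc `EnstrophyPersistence`, same
conclusion under the SHARP box bound).** -/
def SharpEnstrophyPersistence : Prop :=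
  ∀ M₁ γ δ Γ₂ : ℝ, 1 ≤ M₁ → 0 < γ → 0 < δ → 1 ≤ Γ₂ → ∃ K c : ℝ, Γ₂ ≤ K ∧ 0 < c ∧
    ∀ (T : ℝ) (u : ℝ → (EuclideanSpace ℝ (Fin 3)) → (EuclideanSpace ℝ (Fin 3))) (p : ℝ → (EuclideanSpace ℝ (Fin 3)) → ℝ),
      IsClassicalNSSolutionOn (Icc 0 T) 1 0 u p →
      ∀ (y : (EuclideanSpace ℝ (Fin 3))) (σ t t₁ : ℝ), 0 < σ → 0 ≤ t → t ≤ t₁ → t₁ ≤ T → t₁ ≤ t + σ ^ 2 →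
        SharpBoxBound M₁ γ σ u y (Icc t t₁) (2 * K * σ) →
        ENNReal.ofReal (δ / σ) ≤ ∫⁻ x in ball y (Γ₂ * σ), ‖curl (u t) x‖ₑ ^ 2 →
        ENNReal.ofReal (c / σ) ≤ ∫⁻ x in ball y (K * σ), ‖curl (u t₁) x‖ₑ ^ 2

/-- **`SmoothVanishingWitness`** (v1.1: class `C¹₂`) — the rigid object of the smooth route, NORMALISED (unit
time span, amplitude `≤ 1`): a vector field `ω : ℝ → ℝ³ → ℝ³`, globally continuous, jointly `C¹` on the open
slab `(0,1) × ℝ³` WITH JOINTLY `C¹` SPATIAL GRADIENT (the clause `∀ e', (s,x) ↦ D(ω s)(x) e' ∈ C¹` — the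
tree's class `C¹₂` of `Carleman.backwardUniqueness_uncurried_c12`; it costs L♯2 one more derivative of the
failing family, supplied by Sa♯/Sv♯ v1.1), with `C²` slices, bounded gradient / time derivative / Hessian on
the slab, satisfying the FORWARD caloric inequality `|∂ₛω − Δω| ≤ B(|ω| + |∇ω|)` pointwise on the slab,
vanishing identically at the END time `s = 1` and not identically at `s = 0`. -/
def SmoothVanishingWitness : Prop :=
  ∃ (B : ℝ) (ω : ℝ → (EuclideanSpace ℝ (Fin 3)) → (EuclideanSpace ℝ (Fin 3))), 0 ≤ B ∧
    Continuous (uncurry ω) ∧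
    ContDiffOn ℝ 1 (uncurry ω) (Ioo (0 : ℝ) 1 ×ˢ (univ : Set (EuclideanSpace ℝ (Fin 3)))) ∧
    (∀ e' : (EuclideanSpace ℝ (Fin 3)), ContDiffOn ℝ 1 (fun z : ℝ × (EuclideanSpace ℝ (Fin 3)) => fderiv ℝ (ω z.1) z.2 e')
      (Ioo (0 : ℝ) 1 ×ˢ (univ : Set (EuclideanSpace ℝ (Fin 3))))) ∧
    (∀ s ∈ Ioo (0 : ℝ) 1, ContDiff ℝ 2 (ω s)) ∧
    (∀ s ∈ Ioo (0 : ℝ) 1, ∀ x : (EuclideanSpace ℝ (Fin 3)), DifferentiableAt ℝ (fun r => ω r x) s) ∧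
    (∀ s : ℝ, ∀ x : (EuclideanSpace ℝ (Fin 3)), ‖ω s x‖ ≤ 1) ∧
    (∀ s ∈ Ioo (0 : ℝ) 1, ∀ x : (EuclideanSpace ℝ (Fin 3)),
      ‖fderiv ℝ (ω s) x‖ ≤ B ∧ ‖timeDeriv ω s x‖ ≤ B ∧ ‖iteratedFDeriv ℝ 2 (ω s) x‖ ≤ B) ∧
    (∀ s ∈ Ioo (0 : ℝ) 1, ∀ x : (EuclideanSpace ℝ (Fin 3)),
      ‖timeDeriv ω s x - (Δ (ω s)) x‖ ≤ B * (‖ω s x‖ + ‖fderiv ℝ (ω s) x‖)) ∧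
    (∀ x : (EuclideanSpace ℝ (Fin 3)), ω 1 x = 0) ∧
    ∃ x : (EuclideanSpace ℝ (Fin 3)), ω 0 x ≠ 0

/-- A NORMALISED SMOOTH FAILING FAMILY for `DriftStretchSilencingCost` at constants `(B,δ,Γ₂)`: scale
`σ = 1`, centre `0`, initial time `0`, horizon `s₁ ∈ (0,1]`, aperture `K = Γ₂ + n`, floor missed below
`1/(n+1)`: pairs `(ωₙ,vₙ)` in the drift–stretch class on `[0,s₁] × B(0, 2(Γ₂+n))` with initial centre mass
`≥ δ` on `B(0,Γ₂)` and final mass `< 1/(n+1)` on `B(0,Γ₂+n)`. -/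
def SmoothFailingFamily : Prop :=
  ∃ B γ δ Γ₂ : ℝ, 1 ≤ B ∧ 0 < γ ∧ 0 < δ ∧ 1 ≤ Γ₂ ∧
    ∀ n : ℕ, ∃ (ω v : ℝ → (EuclideanSpace ℝ (Fin 3)) → (EuclideanSpace ℝ (Fin 3))) (s₁ : ℝ), 0 < s₁ ∧ s₁ ≤ 1 ∧
    DriftStretchBox B γ 1 ω v 0 (Icc 0 s₁) (2 * (Γ₂ + n)) ∧
    ENNReal.ofReal δ ≤ ∫⁻ x in ball (0 : (EuclideanSpace ℝ (Fin 3))) Γ₂, ‖ω 0 x‖ₑ ^ 2 ∧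
    ∫⁻ x in ball (0 : (EuclideanSpace ℝ (Fin 3))) (Γ₂ + n), ‖ω s₁ x‖ₑ ^ 2 < ENNReal.ofReal (1 / ((n : ℝ) + 1))

/-- L♯1 statement: NORMALISATION. -/
def SmoothNormalisation : Prop := ¬ DriftStretchSilencingCost → SmoothFailingFamily

/-- L♯2 statement: COMPACTNESS with a limit in the class `C¹₂` (jointly `C¹`, spatial gradient jointly `C¹`). -/
def SmoothLimitStep : Prop := SmoothFailingFamily → SmoothVanishingWitness

end

end Summit.NavierStokesRegularity.NavierStokesRegularity.Cruxes.TypeIQuantSubcubicExp.SmoothSilence
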